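import Summits.QuantumFields.BalabanUV.Beta.GAN24.FibreRate
import Summits.QuantumFields.BalabanUV.Beta.GAN24.FibreRateTBlockRatio

/-!
# `BalabanUV.Beta.GAN24.FibreRateJM` — binder row G-an2-4 ∕ (CONV-C), lineage gan24-p3, for road FP's X1m-K: **ROAD P1's FOUR LEG RATES (row L11, Part B)
# RE-RUN FOR THE (j, m)-FAMILY** — consecutive members `(N, M) = (Lc^(j+m), Lc^j)` and `(N′, M′) = (Lc^(j+1+m), Lc^(j+1))`, RATIO `Lc^m`, step `Lc`,
# literal units `(sfStep Lc j, smStep 3 Lc j)`: the mm ∕ mf ∕ fm ∕ ff one-step differences of the closed-form alias sums are `≤ c·(Lc⁻²)^j` with the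
# `q`-UNIFORM constants `cmm (Lc^m)`, `cMF (Lc^m)`, `cMF (Lc^m)`, `cFF (Lc^m)` — road P1's own constants READ AT RATIO `Lc^m`

NOT IN PRINT; OUR PROOF.  Every estimate is road P1's (N ≤ N′)-generic core BY NAME — `CapacitanceRateScaled.scaled_cap_inv_inl_inl_rate` (mm),
`FibreRateMF.norm_scaled_phiSol_sub_le` (mf), `FibreRateFeed.norm_scaled_fm_sub_le` (fm), `FibreRateFeedFF.norm_scaled_feed_sub_le` + this lineage's
`FibreRateTBlockRatio.norm_tSum_jm_step_le` (ff; the ONE input of row L11 that was typed for step = ratio only), fed with `FibreRateData`'s source ∕ reading data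
at ratio `Lc := Lc^m` and `FibreRate`'s pole-free envelopes `uPhi ∕ uC ∕ vC` at `Lc^m`; what is NEW is only the unit bookkeeping `sf_j² = N²∕Lc^{2m}`,
`sf_j·sm_j = N⁵∕Lc^{5m}`, `sm_j² = N⁸∕Lc^{8m}` (`N = Lc^(j+m)`) in place of leaf-20's `m = 1` identities.  HONEST FRAMING (cell contract, verbatim): «discharging
`BetaPertH` makes Bałaban's UV stability UNCONDITIONAL — a real constructive-QFT result; it is NOT the continuum limit and NOT the Clay problem.»  HONEST DEPENDENCY
(verbatim): «continuum YM on T⁴ ⇐ BetaPertH ∧ nine spine estimates (0/9 proved); BetaPertH ⇐ (D1) ∧ (D4) ∧ CAP+tail; G-an2-4 gates asym, D1 and NE2/3/4.»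
HONEST: four leg estimates of the CLOSED FORM `AliasObjects.kFibClosedW` at real `q ≠ 0`; the assembly into `PerfectResolventFibre.RealRateKM` is the companion
`GAN24/RealRateKMHolds`; 0 wall binders; NOT «X1m closed» by this file alone, NEVER «G-an2-4 closed», NOT BetaPertH, NOT continuum, NOT Clay.  ABSOLUTE RULE (cell,
verbatim): «No internally-minted statement may enter as a cited fact. Every hypothesis is either kernel-proved in this package or a verbatim quotation of a PUBLISHED
theorem with page reference.»  Nothing is cited; no `def`; every input is a tree theorem imported BY NAME.
-/

noncomputable section

open Complex Finset
open scoped BigOperators Real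

namespace Summit.QuantumFields.BalabanUV.Beta.GAN24.FibreRateJM

open Literature.Probability.LatticeModels (TorusSite)
open Literature.MathematicalPhysics.QuantumFieldTheory.Balaban1983to89.B4Strip (ofRealVec)
open Literature.MathematicalPhysics.QuantumFieldTheory.Balaban1983to89.B4ContourShift (BZ)
open Literature.MathematicalPhysics.QuantumFieldTheory.King1986 (momSq momSq_nonneg)
open AliasObjects (cap phiSol cSol srcPhi srcC readW Ahat fhatF eVec)
open FibreRateFeedTerms (rPhiTerm rCTerm)
open FibreRateTBlockSum (tSum tConst tConst_nonneg)
open CombesThomas (sfStep smStep)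
open CapacitanceEndpointBlocks (cPP cPc ccc cPP_pos cPc_pos ccc_pos)
open CapacitanceScalarBounds (momSq_pos)
open CapacitanceRateScaled (crPP crPc crcc scaled_cap_inv_inl_inl_rate)
open FibreRateMM (phiSol_zero_eVec)
open FibreRateMF (norm_scaled_phiSol_sub_le)
open FibreRateFeed (sum_readW_Ahat_fhatF norm_scaled_fm_sub_le)
open FibreRateFeedFF (norm_scaled_feed_sub_le)
open FibreRateLegsD3 (sum_tTerm_eq)
open FibreRateOfLegs (cmm abs_le_pi_of_mem_BZ crPP_nonneg)
open FibreRateData (bPhi bC rPhi rC rPhi_nonneg srcPhi_bound srcC_bound srcPhi_rate' srcC_rate' rPhi_bound rC_bound rPhi_rate rC_rate)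
open FibreRate (uPhi uC vC cMF cFF sq_mul_bPhi cube_mul_bC sqrt_mul_rC sqrt_momSq_le crPc_nonneg crcc_nonneg)
open FibreRateTBlockRatio (norm_tSum_jm_step_le)

variable {Lc : ℕ} [NeZero Lc]

/-! ## §1 The units of the (j, m)-family against the blocking `N = Lc^(j+m)` -/

omit [NeZero Lc] in
/-- [folklore] `((Lc^(j+m) : ℕ) : ℂ) = (Lc : ℂ)^j · (Lc : ℂ)^m`. -/
theorem cast_pow_add (j m : ℕ) : (((Lc ^ (j + m) : ℕ) : ℂ)) = (Lc : ℂ) ^ j * (Lc : ℂ) ^ m := by push_cast; exact pow_add _ _ _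

/-- [folklore] **ff UNIT**: `sf_j² · F = (Lc^{2m})⁻¹ · (N² · F)`, `N = Lc^(j+m)`. -/
theorem sfsf_mul_eq (m j : ℕ) (F : ℂ) :
    ((sfStep Lc j * sfStep Lc j : ℝ) : ℂ) * F = ((((Lc ^ m : ℕ) : ℂ)) ^ 2)⁻¹ * ((((Lc ^ (j + m) : ℕ) : ℂ)) ^ 2 * F) := by
  have hL : (Lc : ℂ) ≠ 0 := Nat.cast_ne_zero.2 (NeZero.ne Lc)
  unfold CombesThomas.sfStep
  rw [cast_pow_add]
  push_cast
  field_simp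

/-- [folklore] **fm ∕ mf UNIT**: `sf_j · sm_j · F = (Lc^{5m})⁻¹ · (N⁵ · F)` (`d = 3`: `sf_j sm_j = Lc^{5j}`). -/
theorem sfsm_mul_eq (m j : ℕ) (F : ℂ) :
    ((sfStep Lc j * smStep 3 Lc j : ℝ) : ℂ) * F = ((((Lc ^ m : ℕ) : ℂ)) ^ 5)⁻¹ * ((((Lc ^ (j + m) : ℕ) : ℂ)) ^ (3 + 1 + 1) * F) := by
  have hL : (Lc : ℂ) ≠ 0 := Nat.cast_ne_zero.2 (NeZero.ne Lc)
  unfold CombesThomas.sfStep CombesThomas.smStep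
  rw [cast_pow_add]
  push_cast
  field_simp
  ring

/-- [folklore] The same with the factors in the other order. -/
theorem smsf_mul_eq (m j : ℕ) (F : ℂ) :
    ((smStep 3 Lc j * sfStep Lc j : ℝ) : ℂ) * F = ((((Lc ^ m : ℕ) : ℂ)) ^ 5)⁻¹ * ((((Lc ^ (j + m) : ℕ) : ℂ)) ^ (3 + 1 + 1) * F) := by
  rw [mul_comm (smStep 3 Lc j), sfsm_mul_eq]

/-- [folklore] **mm UNIT**: `sm_j² · phiSol_N (0, e_l)_κ = (Lc^{8m})⁻¹ · (N⁸ · (cap N p)⁻¹ (inl κ) (inl l))` (`FibreRateMM.phiSol_zero_eVec`). -/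
theorem smsm_mul_phiSol_eq (m j : ℕ) (p : Fin (3 + 1) → ℂ) (l κ : Fin (3 + 1)) :
    ((smStep 3 Lc j * smStep 3 Lc j : ℝ) : ℂ) * phiSol (Lc ^ (j + m)) p 0 (eVec l) κ
      = ((((Lc ^ m : ℕ) : ℂ)) ^ 8)⁻¹ * ((((Lc ^ (j + m) : ℕ) : ℂ)) ^ (3 + 1 + 4) * (cap (Lc ^ (j + m)) p)⁻¹ (Sum.inl κ) (Sum.inl l)) := by
  have hL : (Lc : ℂ) ≠ 0 := Nat.cast_ne_zero.2 (NeZero.ne Lc)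
  rw [phiSol_zero_eVec]
  unfold CombesThomas.smStep
  rw [cast_pow_add]
  push_cast
  field_simp
  ring

omit [NeZero Lc] in
/-- [folklore] **THE RATE ALGEBRA**: `((Lc^m)^k)⁻¹ · K∕N² = K∕(Lc^m)^{k+2} · (Lc⁻²)^j` for `N = Lc^(j+m)`. -/
theorem rate_algebra (hL : (Lc : ℝ) ≠ 0) (k m j : ℕ) (K : ℝ) :
    ((((Lc ^ m : ℕ) : ℝ)) ^ k)⁻¹ * (K / ((((Lc ^ (j + m) : ℕ) : ℝ)) ^ 2)) = K / (((Lc ^ m : ℕ) : ℝ)) ^ (k + 2) * (((Lc : ℝ) ^ 2)⁻¹) ^ j := by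
  have e1 : (((Lc ^ (j + m) : ℕ) : ℝ)) = (Lc : ℝ) ^ j * (Lc : ℝ) ^ m := by push_cast; exact pow_add _ _ _
  have e2 : (((Lc ^ m : ℕ) : ℝ)) = (Lc : ℝ) ^ m := by push_cast; rfl
  rw [e1, e2, inv_pow, ← pow_mul]
  field_simp
  ring

omit [NeZero Lc] in
/-- [folklore] `1 ≤ Lc^(j+m)` and `Lc^(j+m) ≤ Lc^(j+1+m)` for `Lc ≥ 1`. -/
theorem pow_facts (hLc1 : 1 ≤ Lc) (m j : ℕ) : 1 ≤ Lc ^ (j + m) ∧ Lc ^ (j + m) ≤ Lc ^ (j + 1 + m) :=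
  ⟨Nat.one_le_pow _ _ hLc1, Nat.pow_le_pow_right hLc1 (by omega)⟩

/-! ## §2 The four leg rates at (j, m) as functions of the alias-sum data -/

section Data
variable (m j : ℕ) {q : Fin (3 + 1) → ℝ}

/-- **mm LEG at (j, m)** [folklore]: `‖sm_{j+1}²·φ_{N′}(0,e_l)_κ − sm_j²·φ_N(0,e_l)_κ‖ ≤ crPP 4·|q|⁴∕(Lc^m)^{10} · (Lc⁻²)^j` on `[-π,π]⁴ ∖ {0}`. -/
theorem mm_rate (hq : ∀ i, |q i| ≤ π) (hq0 : q ≠ 0) (κ l : Fin (3 + 1)) :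
    ‖((smStep 3 Lc (j + 1) * smStep 3 Lc (j + 1) : ℝ) : ℂ) * phiSol (Lc ^ (j + 1 + m)) (ofRealVec q) 0 (eVec l) κ
        - ((smStep 3 Lc j * smStep 3 Lc j : ℝ) : ℂ) * phiSol (Lc ^ (j + m)) (ofRealVec q) 0 (eVec l) κ‖
      ≤ crPP (3 + 1) * momSq q ^ 2 / (((Lc ^ m : ℕ) : ℝ)) ^ 10 * (((Lc : ℝ) ^ 2)⁻¹) ^ j := by
  have hLc1 : 1 ≤ Lc := Nat.one_le_iff_ne_zero.2 (NeZero.ne Lc)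
  have hL : (Lc : ℝ) ≠ 0 := Nat.cast_ne_zero.2 (NeZero.ne Lc)
  obtain ⟨hN, hNN'⟩ := pow_facts hLc1 m j
  have h := scaled_cap_inv_inl_inl_rate (D := 3 + 1) hN hNN' hq hq0 κ l
  rw [smsm_mul_phiSol_eq m (j + 1), smsm_mul_phiSol_eq m j, ← mul_sub, norm_mul, norm_inv, norm_pow, Complex.norm_natCast,
    ← rate_algebra hL 8 m j]
  exact mul_le_mul_of_nonneg_left h (by positivity)

/-- **mf LEG at (j, m), AS A FUNCTION OF THE SOURCE-SIDE DATA** [folklore] (`FibreRateMF.norm_scaled_phiSol_sub_le` at `N = Lc^(j+m) ≤ N′ = Lc^(j+1+m)`). -/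
theorem mf_rate_of_source_data (hq : ∀ i, |q i| ≤ π) (hq0 : q ≠ 0)
    {fhat : TorusSite (3 + 1) (Lc ^ (j + m)) → Fin (3 + 1) → ℂ} {fhat' : TorusSite (3 + 1) (Lc ^ (j + 1 + m)) → Fin (3 + 1) → ℂ} {Bφ Bc Rφ Rc : ℝ}
    (hBφ : ∀ l', ‖((((Lc ^ (j + 1 + m) : ℕ) : ℂ) ^ 3)⁻¹) * srcPhi (Lc ^ (j + 1 + m)) (ofRealVec q) fhat' 0 l'‖ ≤ Bφ)
    (hBc : ‖((((Lc ^ (j + 1 + m) : ℕ) : ℂ) ^ 3)⁻¹) * srcC (Lc ^ (j + 1 + m)) (ofRealVec q) fhat'‖ ≤ Bc)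
    (hRφ : ∀ l', ‖((((Lc ^ (j + 1 + m) : ℕ) : ℂ) ^ 3)⁻¹) * srcPhi (Lc ^ (j + 1 + m)) (ofRealVec q) fhat' 0 l'
        - ((((Lc ^ (j + m) : ℕ) : ℂ) ^ 3)⁻¹) * srcPhi (Lc ^ (j + m)) (ofRealVec q) fhat 0 l'‖ ≤ Rφ / (((Lc ^ (j + m) : ℕ) : ℝ)) ^ 2)
    (hRc : ‖((((Lc ^ (j + 1 + m) : ℕ) : ℂ) ^ 3)⁻¹) * srcC (Lc ^ (j + 1 + m)) (ofRealVec q) fhat'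
        - ((((Lc ^ (j + m) : ℕ) : ℂ) ^ 3)⁻¹) * srcC (Lc ^ (j + m)) (ofRealVec q) fhat‖ ≤ Rc / (((Lc ^ (j + m) : ℕ) : ℝ)) ^ 2) (κ : Fin (3 + 1)) :
    ‖((smStep 3 Lc (j + 1) * sfStep Lc (j + 1) : ℝ) : ℂ) * phiSol (Lc ^ (j + 1 + m)) (ofRealVec q) fhat' 0 κ
        - ((smStep 3 Lc j * sfStep Lc j : ℝ) : ℂ) * phiSol (Lc ^ (j + m)) (ofRealVec q) fhat 0 κ‖
      ≤ ((3 + 1 : ℕ) * (crPP (3 + 1) * momSq q ^ 2 * Bφ + cPP (3 + 1) * momSq q * Rφ)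
          + crPc (3 + 1) * (momSq q ^ 2 * Real.sqrt (momSq q)) * Bc + cPc (3 + 1) * (momSq q * Real.sqrt (momSq q)) * Rc) / (((Lc ^ m : ℕ) : ℝ)) ^ 7
        * (((Lc : ℝ) ^ 2)⁻¹) ^ j := by
  have hLc1 : 1 ≤ Lc := Nat.one_le_iff_ne_zero.2 (NeZero.ne Lc)
  have hL : (Lc : ℝ) ≠ 0 := Nat.cast_ne_zero.2 (NeZero.ne Lc)
  obtain ⟨hN, hNN'⟩ := pow_facts hLc1 m j
  have h := norm_scaled_phiSol_sub_le (D := 3 + 1) hN hNN' hq hq0 hBφ hBc hRφ hRc κ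
  rw [smsf_mul_eq m (j + 1), smsf_mul_eq m j, ← mul_sub, norm_mul, norm_inv, norm_pow, Complex.norm_natCast,
    ← rate_algebra hL 5 m j]
  refine mul_le_mul_of_nonneg_left ?_ (by positivity)
  convert h using 2

/-- **fm LEG at (j, m), AS A FUNCTION OF THE READING-SIDE DATA** [folklore] (`FibreRateFeed.norm_scaled_fm_sub_le` at `N = Lc^(j+m) ≤ N′ = Lc^(j+1+m)`). -/
theorem fm_rate_of_reading_data (hq : ∀ i, |q i| ≤ π) (hq0 : q ≠ 0) (κ l : Fin (3 + 1)) (x' : Fin (3 + 1) → ℤ) {Aφ Ac Qφ Qc : ℝ}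
    (hAφ : ∀ l', ‖((((Lc ^ (j + m) : ℕ) : ℂ) ^ 3)⁻¹) * ∑ n, rPhiTerm (Lc ^ (j + m)) (Lc ^ j) (ofRealVec q) n κ l' x'‖ ≤ Aφ)
    (hAc : ‖((((Lc ^ (j + m) : ℕ) : ℂ) ^ 3)⁻¹) * ∑ n, rCTerm (Lc ^ (j + m)) (Lc ^ j) (ofRealVec q) n κ x'‖ ≤ Ac)
    (hQφ : ∀ l', ‖((((Lc ^ (j + 1 + m) : ℕ) : ℂ) ^ 3)⁻¹) * ∑ n, rPhiTerm (Lc ^ (j + 1 + m)) (Lc ^ (j + 1)) (ofRealVec q) n κ l' x'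
        - ((((Lc ^ (j + m) : ℕ) : ℂ) ^ 3)⁻¹) * ∑ n, rPhiTerm (Lc ^ (j + m)) (Lc ^ j) (ofRealVec q) n κ l' x'‖ ≤ Qφ / (((Lc ^ (j + m) : ℕ) : ℝ)) ^ 2)
    (hQc : ‖((((Lc ^ (j + 1 + m) : ℕ) : ℂ) ^ 3)⁻¹) * ∑ n, rCTerm (Lc ^ (j + 1 + m)) (Lc ^ (j + 1)) (ofRealVec q) n κ x'
        - ((((Lc ^ (j + m) : ℕ) : ℂ) ^ 3)⁻¹) * ∑ n, rCTerm (Lc ^ (j + m)) (Lc ^ j) (ofRealVec q) n κ x'‖ ≤ Qc / (((Lc ^ (j + m) : ℕ) : ℝ)) ^ 2) :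
    ‖((sfStep Lc (j + 1) * smStep 3 Lc (j + 1) : ℝ) : ℂ) * ∑ n', readW (Lc ^ (j + 1 + m)) (Lc ^ (j + 1)) (ofRealVec q) n' κ x' *
          Ahat (Lc ^ (j + 1 + m)) (ofRealVec q) 0 (eVec l) n' κ
        - ((sfStep Lc j * smStep 3 Lc j : ℝ) : ℂ) * ∑ n, readW (Lc ^ (j + m)) (Lc ^ j) (ofRealVec q) n κ x' *
          Ahat (Lc ^ (j + m)) (ofRealVec q) 0 (eVec l) n κ‖
      ≤ ((3 + 1 : ℕ) * (Qφ * (cPP (3 + 1) * momSq q) + Aφ * (crPP (3 + 1) * momSq q ^ 2))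
          + Qc * (cPc (3 + 1) * (momSq q * Real.sqrt (momSq q))) + Ac * (crPc (3 + 1) * (momSq q ^ 2 * Real.sqrt (momSq q)))) / (((Lc ^ m : ℕ) : ℝ)) ^ 7
        * (((Lc : ℝ) ^ 2)⁻¹) ^ j := by
  have hLc1 : 1 ≤ Lc := Nat.one_le_iff_ne_zero.2 (NeZero.ne Lc)
  have hL : (Lc : ℝ) ≠ 0 := Nat.cast_ne_zero.2 (NeZero.ne Lc)
  obtain ⟨hN, hNN'⟩ := pow_facts hLc1 m j
  have h := norm_scaled_fm_sub_le (D := 3 + 1) hN hNN' hq hq0 (Lc ^ j) (Lc ^ (j + 1)) κ l x' hAφ hAc hQφ hQc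
  rw [sfsm_mul_eq m (j + 1), sfsm_mul_eq m j, ← mul_sub, norm_mul, norm_inv, norm_pow, Complex.norm_natCast,
    ← rate_algebra hL 5 m j]
  refine mul_le_mul_of_nonneg_left ?_ (by positivity)
  convert h using 2

/-- [folklore] **THE ff READOUT IN THE LITERAL UNITS, SPLIT, at (j, m)**: `sf_j²·Σ_n readW·Â(f̂, 0) = (Lc^{2m})⁻¹·(tSum + N⁻³·N⁵·feed)`, `N = Lc^(j+m)`, `M = Lc^j`
(`FibreRateFeed.sum_readW_Ahat_fhatF`, `FibreRateLegsD3.sum_tTerm_eq`). -/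
theorem sf_sq_mul_ff_eq (q : Fin (3 + 1) → ℝ) (κ l : Fin (3 + 1)) (x' y' : Fin (3 + 1) → ℤ) :
    ((sfStep Lc j * sfStep Lc j : ℝ) : ℂ) * ∑ n, readW (Lc ^ (j + m)) (Lc ^ j) (ofRealVec q) n κ x' *
        Ahat (Lc ^ (j + m)) (ofRealVec q) (fhatF (Lc ^ (j + m)) (Lc ^ j) (ofRealVec q) l y') 0 n κ
      = ((((Lc ^ m : ℕ) : ℂ)) ^ 2)⁻¹ * (tSum (Lc ^ (j + m)) (Lc ^ j) q κ l x' y'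
          + ((((Lc ^ (j + m) : ℕ) : ℂ) ^ 3)⁻¹) * ((((Lc ^ (j + m) : ℕ) : ℂ) ^ (3 + 1 + 1)) *
            (∑ l', (∑ n, rPhiTerm (Lc ^ (j + m)) (Lc ^ j) (ofRealVec q) n κ l' x') *
                phiSol (Lc ^ (j + m)) (ofRealVec q) (fhatF (Lc ^ (j + m)) (Lc ^ j) (ofRealVec q) l y') 0 l'
              + (∑ n, rCTerm (Lc ^ (j + m)) (Lc ^ j) (ofRealVec q) n κ x') *
                cSol (Lc ^ (j + m)) (ofRealVec q) (fhatF (Lc ^ (j + m)) (Lc ^ j) (ofRealVec q) l y') 0))) := by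
  have hN : (((Lc ^ (j + m) : ℕ) : ℂ)) ≠ 0 := by exact_mod_cast pow_ne_zero _ (NeZero.ne Lc)
  rw [sum_readW_Ahat_fhatF, sum_tTerm_eq, sfsf_mul_eq m j]
  congr 1
  field_simp
  ring

/-- **ff LEG at (j, m), AS A FUNCTION OF THE ALIAS-SUM DATA** [folklore]: with the T-sum rate `‖tSum_{N′,M′} − tSum_{N,M}‖ ≤ T∕N²` (supplied at ratio `Lc^m` by
`FibreRateTBlockRatio.norm_tSum_jm_step_le`), reading data `(A_φ, A_c; Q_φ, Q_c)` and source data `(B_φ, B_c; R_φ, R_c)`: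
`‖sf_{j+1}²·FF_{j+1} − sf_j²·FF_j‖ ≤ (T + feed)∕(Lc^m)⁴ · (Lc⁻²)^j` (`FibreRateFeedFF.norm_scaled_feed_sub_le` at `N ≤ N′`). -/
theorem ff_rate_of_data (hq : ∀ i, |q i| ≤ π) (hq0 : q ≠ 0) (κ l : Fin (3 + 1)) (x' y' : Fin (3 + 1) → ℤ)
    {T Aφ Ac Qφ Qc Bφ Bc Rφ Rc : ℝ}
    (hT : ‖tSum (Lc ^ (j + 1 + m)) (Lc ^ (j + 1)) q κ l x' y' - tSum (Lc ^ (j + m)) (Lc ^ j) q κ l x' y'‖ ≤ T / (((Lc ^ (j + m) : ℕ) : ℝ)) ^ 2)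
    (hAφ : ∀ l', ‖((((Lc ^ (j + m) : ℕ) : ℂ) ^ 3)⁻¹) * ∑ n, rPhiTerm (Lc ^ (j + m)) (Lc ^ j) (ofRealVec q) n κ l' x'‖ ≤ Aφ)
    (hAc : ‖((((Lc ^ (j + m) : ℕ) : ℂ) ^ 3)⁻¹) * ∑ n, rCTerm (Lc ^ (j + m)) (Lc ^ j) (ofRealVec q) n κ x'‖ ≤ Ac)
    (hQφ : ∀ l', ‖((((Lc ^ (j + 1 + m) : ℕ) : ℂ) ^ 3)⁻¹) * ∑ n, rPhiTerm (Lc ^ (j + 1 + m)) (Lc ^ (j + 1)) (ofRealVec q) n κ l' x'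
        - ((((Lc ^ (j + m) : ℕ) : ℂ) ^ 3)⁻¹) * ∑ n, rPhiTerm (Lc ^ (j + m)) (Lc ^ j) (ofRealVec q) n κ l' x'‖ ≤ Qφ / (((Lc ^ (j + m) : ℕ) : ℝ)) ^ 2)
    (hQc : ‖((((Lc ^ (j + 1 + m) : ℕ) : ℂ) ^ 3)⁻¹) * ∑ n, rCTerm (Lc ^ (j + 1 + m)) (Lc ^ (j + 1)) (ofRealVec q) n κ x'
        - ((((Lc ^ (j + m) : ℕ) : ℂ) ^ 3)⁻¹) * ∑ n, rCTerm (Lc ^ (j + m)) (Lc ^ j) (ofRealVec q) n κ x'‖ ≤ Qc / (((Lc ^ (j + m) : ℕ) : ℝ)) ^ 2)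
    (hBφ : ∀ l', ‖((((Lc ^ (j + 1 + m) : ℕ) : ℂ) ^ 3)⁻¹) *
        srcPhi (Lc ^ (j + 1 + m)) (ofRealVec q) (fhatF (Lc ^ (j + 1 + m)) (Lc ^ (j + 1)) (ofRealVec q) l y') 0 l'‖ ≤ Bφ)
    (hBc : ‖((((Lc ^ (j + 1 + m) : ℕ) : ℂ) ^ 3)⁻¹) * srcC (Lc ^ (j + 1 + m)) (ofRealVec q) (fhatF (Lc ^ (j + 1 + m)) (Lc ^ (j + 1)) (ofRealVec q) l y')‖ ≤ Bc)
    (hRφ : ∀ l', ‖((((Lc ^ (j + 1 + m) : ℕ) : ℂ) ^ 3)⁻¹) * srcPhi (Lc ^ (j + 1 + m)) (ofRealVec q) (fhatF (Lc ^ (j + 1 + m)) (Lc ^ (j + 1)) (ofRealVec q) l y') 0 l'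
        - ((((Lc ^ (j + m) : ℕ) : ℂ) ^ 3)⁻¹) * srcPhi (Lc ^ (j + m)) (ofRealVec q) (fhatF (Lc ^ (j + m)) (Lc ^ j) (ofRealVec q) l y') 0 l'‖
        ≤ Rφ / (((Lc ^ (j + m) : ℕ) : ℝ)) ^ 2)
    (hRc : ‖((((Lc ^ (j + 1 + m) : ℕ) : ℂ) ^ 3)⁻¹) * srcC (Lc ^ (j + 1 + m)) (ofRealVec q) (fhatF (Lc ^ (j + 1 + m)) (Lc ^ (j + 1)) (ofRealVec q) l y')
        - ((((Lc ^ (j + m) : ℕ) : ℂ) ^ 3)⁻¹) * srcC (Lc ^ (j + m)) (ofRealVec q) (fhatF (Lc ^ (j + m)) (Lc ^ j) (ofRealVec q) l y')‖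
        ≤ Rc / (((Lc ^ (j + m) : ℕ) : ℝ)) ^ 2) :
    ‖((sfStep Lc (j + 1) * sfStep Lc (j + 1) : ℝ) : ℂ) * ∑ n', readW (Lc ^ (j + 1 + m)) (Lc ^ (j + 1)) (ofRealVec q) n' κ x' *
          Ahat (Lc ^ (j + 1 + m)) (ofRealVec q) (fhatF (Lc ^ (j + 1 + m)) (Lc ^ (j + 1)) (ofRealVec q) l y') 0 n' κ
        - ((sfStep Lc j * sfStep Lc j : ℝ) : ℂ) * ∑ n, readW (Lc ^ (j + m)) (Lc ^ j) (ofRealVec q) n κ x' *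
          Ahat (Lc ^ (j + m)) (ofRealVec q) (fhatF (Lc ^ (j + m)) (Lc ^ j) (ofRealVec q) l y') 0 n κ‖
      ≤ (T + ((3 + 1 : ℕ) * (Qφ * ((3 + 1 : ℕ) * (cPP (3 + 1) * momSq q * Bφ) + cPc (3 + 1) * (momSq q * Real.sqrt (momSq q)) * Bc)
              + Aφ * ((3 + 1 : ℕ) * (crPP (3 + 1) * momSq q ^ 2 * Bφ + cPP (3 + 1) * momSq q * Rφ)
                + crPc (3 + 1) * (momSq q ^ 2 * Real.sqrt (momSq q)) * Bc + cPc (3 + 1) * (momSq q * Real.sqrt (momSq q)) * Rc))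
          + Qc * ((3 + 1 : ℕ) * (cPc (3 + 1) * (momSq q * Real.sqrt (momSq q)) * Bφ) + ccc (3 + 1) * momSq q ^ 2 * Bc)
          + Ac * ((3 + 1 : ℕ) * (crPc (3 + 1) * (momSq q ^ 2 * Real.sqrt (momSq q)) * Bφ + cPc (3 + 1) * (momSq q * Real.sqrt (momSq q)) * Rφ)
                + crcc (3 + 1) * momSq q ^ 3 * Bc + ccc (3 + 1) * momSq q ^ 2 * Rc))) / (((Lc ^ m : ℕ) : ℝ)) ^ 4
        * (((Lc : ℝ) ^ 2)⁻¹) ^ j := by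
  have hLc1 : 1 ≤ Lc := Nat.one_le_iff_ne_zero.2 (NeZero.ne Lc)
  have hL : (Lc : ℝ) ≠ 0 := Nat.cast_ne_zero.2 (NeZero.ne Lc)
  obtain ⟨hN, hNN'⟩ := pow_facts hLc1 m j
  have hfeed := norm_scaled_feed_sub_le (D := 3 + 1) hN hNN' hq hq0 (Lc ^ j) (Lc ^ (j + 1)) κ x' hAφ hAc hQφ hQc hBφ hBc hRφ hRc
  rw [sf_sq_mul_ff_eq m (j + 1), sf_sq_mul_ff_eq m j, ← mul_sub, norm_mul, norm_inv, norm_pow, Complex.norm_natCast,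
    show ∀ (a b c e : ℂ), (a + b) - (c + e) = (a - c) + (b - e) from fun _ _ _ _ => by ring]
  have hsum := (norm_add_le _ _).trans (add_le_add hT hfeed)
  rw [← add_div] at hsum
  rw [← rate_algebra hL 2 m j]
  refine mul_le_mul_of_nonneg_left ?_ (by positivity)
  convert hsum using 2

end Data

/-! ## §3 The legs with `q`-uniform constants — road P1's `cMF`, `cFF`, `cmm` READ AT RATIO `Lc^m` -/

section Legs

variable {q : Fin (3 + 1) → ℝ}

/-- **mf LEG at (j, m)** [folklore]: `≤ cMF (Lc^m)·(Lc⁻²)^j` on `BZ ∖ {0}` (source data `FibreRateData` at ratio `Lc^m`, envelopes `FibreRate.sq_mul_bPhi` etc. at `Lc^m`). -/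
theorem mf_leg (m j : ℕ) {q : Fin (3 + 1) → ℝ} (hq : q ∈ BZ (3 + 1)) (hq0 : q ≠ 0) (κ l : Fin (3 + 1)) (y' : Fin (3 + 1) → ℤ) :
    ‖((smStep 3 Lc (j + 1) * sfStep Lc (j + 1) : ℝ) : ℂ) *
          phiSol (Lc ^ (j + 1 + m)) (ofRealVec q) (fhatF (Lc ^ (j + 1 + m)) (Lc ^ (j + 1)) (ofRealVec q) l y') 0 κ
        - ((smStep 3 Lc j * sfStep Lc j : ℝ) : ℂ) * phiSol (Lc ^ (j + m)) (ofRealVec q) (fhatF (Lc ^ (j + m)) (Lc ^ j) (ofRealVec q) l y') 0 κ‖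
      ≤ cMF (Lc ^ m) * (((Lc : ℝ) ^ 2)⁻¹) ^ j := by
  have hq' := abs_le_pi_of_mem_BZ hq
  have hLc1 : 1 ≤ Lc := Nat.one_le_iff_ne_zero.2 (NeZero.ne Lc)
  have hLc0 : (0 : ℝ) < Lc := by exact_mod_cast hLc1
  have hNM : Lc ^ (j + m) = Lc ^ j * Lc ^ m := pow_add _ _ _
  have hN'M' : Lc ^ (j + 1 + m) = Lc ^ (j + 1) * Lc ^ m := pow_add _ _ _
  have hNN' : Lc ^ (j + m) ≤ Lc ^ (j + 1 + m) := Nat.pow_le_pow_right hLc1 (by omega)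
  have h := mf_rate_of_source_data m j hq' hq0 (srcPhi_bound hN'M' hq' hq0 l y') (srcC_bound hN'M' hq' hq0 l y')
    (srcPhi_rate' hNM hN'M' hNN' hq' hq0 l y') (srcC_rate' hNM hN'M' hNN' hq' hq0 l y') κ
  refine h.trans (mul_le_mul_of_nonneg_right (div_le_div_of_nonneg_right ?_ (by positivity)) (by positivity))
  have hP := momSq_pos hq0
  set s := Real.sqrt (momSq q) with hs
  have hsP : momSq q = s ^ 2 := (Real.sq_sqrt hP.le).symm
  obtain ⟨hxφ, hxφ0⟩ := sq_mul_bPhi (Lc := Lc ^ m) hq' hq0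
  obtain ⟨hxc, hxc0⟩ := cube_mul_bC (Lc := Lc ^ m) hq' hq0
  obtain ⟨hyc, hyc0⟩ := sqrt_mul_rC (Lc := Lc ^ m) hq' hq0
  obtain ⟨hs2π, hP4⟩ := sqrt_momSq_le hq'
  have hs0 : 0 ≤ s := Real.sqrt_nonneg _
  have hss : s ^ 2 ≤ 4 * π ^ 2 := by rw [← hsP]; exact hP4
  have h1 := (cPP_pos (3 + 1)).le; have h2 := (cPc_pos (3 + 1)).le; have h3 := crPP_nonneg (3 + 1); have h4 := crPc_nonneg (3 + 1)
  have h5 := rPhi_nonneg (Lc ^ m)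
  have hU1 : 0 ≤ uPhi (Lc ^ m) := hxφ0.trans hxφ
  have hU2 : 0 ≤ uC (Lc ^ m) := hxc0.trans hxc
  have hU3 : 0 ≤ vC (Lc ^ m) := hyc0.trans hyc
  rw [hsP]
  calc ((3 + 1 : ℕ) : ℝ) * (crPP (3 + 1) * (s ^ 2) ^ 2 * bPhi (Lc ^ m) q + cPP (3 + 1) * s ^ 2 * rPhi (Lc ^ m))
        + crPc (3 + 1) * ((s ^ 2) ^ 2 * s) * bC (Lc ^ m) q + cPc (3 + 1) * (s ^ 2 * s) * rC (Lc ^ m) q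
      = ((3 + 1 : ℕ) : ℝ) * (crPP (3 + 1) * s ^ 2 * (s ^ 2 * bPhi (Lc ^ m) q) + cPP (3 + 1) * s ^ 2 * rPhi (Lc ^ m))
        + crPc (3 + 1) * s ^ 2 * (s ^ 3 * bC (Lc ^ m) q) + cPc (3 + 1) * s ^ 2 * (s * rC (Lc ^ m) q) := by
          ring
    _ ≤ ((3 + 1 : ℕ) : ℝ) * (crPP (3 + 1) * (4 * π ^ 2) * uPhi (Lc ^ m) + cPP (3 + 1) * (4 * π ^ 2) * rPhi (Lc ^ m))
        + crPc (3 + 1) * (4 * π ^ 2) * uC (Lc ^ m) + cPc (3 + 1) * (4 * π ^ 2) * vC (Lc ^ m) := by gcongr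

/-- **fm LEG at (j, m)** [folklore]: `≤ cMF (Lc^m)·(Lc⁻²)^j` on `BZ ∖ {0}`. -/
theorem fm_leg (m j : ℕ) {q : Fin (3 + 1) → ℝ} (hq : q ∈ BZ (3 + 1)) (hq0 : q ≠ 0) (κ l : Fin (3 + 1)) (x' : Fin (3 + 1) → ℤ) :
    ‖((sfStep Lc (j + 1) * smStep 3 Lc (j + 1) : ℝ) : ℂ) * ∑ n', readW (Lc ^ (j + 1 + m)) (Lc ^ (j + 1)) (ofRealVec q) n' κ x' *
          Ahat (Lc ^ (j + 1 + m)) (ofRealVec q) 0 (eVec l) n' κ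
        - ((sfStep Lc j * smStep 3 Lc j : ℝ) : ℂ) * ∑ n, readW (Lc ^ (j + m)) (Lc ^ j) (ofRealVec q) n κ x' *
          Ahat (Lc ^ (j + m)) (ofRealVec q) 0 (eVec l) n κ‖
      ≤ cMF (Lc ^ m) * (((Lc : ℝ) ^ 2)⁻¹) ^ j := by
  have hq' := abs_le_pi_of_mem_BZ hq
  have hLc1 : 1 ≤ Lc := Nat.one_le_iff_ne_zero.2 (NeZero.ne Lc)
  have hLc0 : (0 : ℝ) < Lc := by exact_mod_cast hLc1
  have hNM : Lc ^ (j + m) = Lc ^ j * Lc ^ m := pow_add _ _ _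
  have hN'M' : Lc ^ (j + 1 + m) = Lc ^ (j + 1) * Lc ^ m := pow_add _ _ _
  have hNN' : Lc ^ (j + m) ≤ Lc ^ (j + 1 + m) := Nat.pow_le_pow_right hLc1 (by omega)
  have h := fm_rate_of_reading_data m j hq' hq0 κ l x' (rPhi_bound hNM hq' hq0 κ x') (rC_bound hNM hq' hq0 κ x')
    (rPhi_rate hNM hN'M' hNN' hq' hq0 κ x') (rC_rate hNM hN'M' hNN' hq' hq0 κ x')
  refine h.trans (mul_le_mul_of_nonneg_right (div_le_div_of_nonneg_right ?_ (by positivity)) (by positivity))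
  have hP := momSq_pos hq0
  set s := Real.sqrt (momSq q) with hs
  have hsP : momSq q = s ^ 2 := (Real.sq_sqrt hP.le).symm
  obtain ⟨hxφ, hxφ0⟩ := sq_mul_bPhi (Lc := Lc ^ m) hq' hq0
  obtain ⟨hxc, hxc0⟩ := cube_mul_bC (Lc := Lc ^ m) hq' hq0
  obtain ⟨hyc, hyc0⟩ := sqrt_mul_rC (Lc := Lc ^ m) hq' hq0
  obtain ⟨hs2π, hP4⟩ := sqrt_momSq_le hq'
  have hs0 : 0 ≤ s := Real.sqrt_nonneg _
  have hss : s ^ 2 ≤ 4 * π ^ 2 := by rw [← hsP]; exact hP4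
  have h1 := (cPP_pos (3 + 1)).le; have h2 := (cPc_pos (3 + 1)).le; have h3 := crPP_nonneg (3 + 1); have h4 := crPc_nonneg (3 + 1)
  have h5 := rPhi_nonneg (Lc ^ m)
  have hU1 : 0 ≤ uPhi (Lc ^ m) := hxφ0.trans hxφ
  have hU2 : 0 ≤ uC (Lc ^ m) := hxc0.trans hxc
  have hU3 : 0 ≤ vC (Lc ^ m) := hyc0.trans hyc
  rw [hsP]
  calc ((3 + 1 : ℕ) : ℝ) * (rPhi (Lc ^ m) * (cPP (3 + 1) * s ^ 2) + bPhi (Lc ^ m) q * (crPP (3 + 1) * (s ^ 2) ^ 2))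
        + rC (Lc ^ m) q * (cPc (3 + 1) * (s ^ 2 * s)) + bC (Lc ^ m) q * (crPc (3 + 1) * ((s ^ 2) ^ 2 * s))
      = ((3 + 1 : ℕ) : ℝ) * (crPP (3 + 1) * s ^ 2 * (s ^ 2 * bPhi (Lc ^ m) q) + cPP (3 + 1) * s ^ 2 * rPhi (Lc ^ m))
        + crPc (3 + 1) * s ^ 2 * (s ^ 3 * bC (Lc ^ m) q) + cPc (3 + 1) * s ^ 2 * (s * rC (Lc ^ m) q) := by
          ring
    _ ≤ ((3 + 1 : ℕ) : ℝ) * (crPP (3 + 1) * (4 * π ^ 2) * uPhi (Lc ^ m) + cPP (3 + 1) * (4 * π ^ 2) * rPhi (Lc ^ m))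
        + crPc (3 + 1) * (4 * π ^ 2) * uC (Lc ^ m) + cPc (3 + 1) * (4 * π ^ 2) * vC (Lc ^ m) := by gcongr

/-- **ff LEG at (j, m)** [folklore]: `≤ cFF (Lc^m)·(Lc⁻²)^j` on `BZ ∖ {0}` for `Lc ≥ 2`, `m ≥ 1` (T-sum at ratio `Lc^m` from `FibreRateTBlockRatio.norm_tSum_jm_step_le`). -/
theorem ff_leg (hLc2 : 2 ≤ Lc) {m : ℕ} (hm : 1 ≤ m) (j : ℕ) {q : Fin (3 + 1) → ℝ} (hq : q ∈ BZ (3 + 1)) (hq0 : q ≠ 0) (κ l : Fin (3 + 1))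
    (x' y' : Fin (3 + 1) → ℤ) :
    ‖((sfStep Lc (j + 1) * sfStep Lc (j + 1) : ℝ) : ℂ) * ∑ n', readW (Lc ^ (j + 1 + m)) (Lc ^ (j + 1)) (ofRealVec q) n' κ x' *
          Ahat (Lc ^ (j + 1 + m)) (ofRealVec q) (fhatF (Lc ^ (j + 1 + m)) (Lc ^ (j + 1)) (ofRealVec q) l y') 0 n' κ
        - ((sfStep Lc j * sfStep Lc j : ℝ) : ℂ) * ∑ n, readW (Lc ^ (j + m)) (Lc ^ j) (ofRealVec q) n κ x' *
          Ahat (Lc ^ (j + m)) (ofRealVec q) (fhatF (Lc ^ (j + m)) (Lc ^ j) (ofRealVec q) l y') 0 n κ‖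
      ≤ cFF (Lc ^ m) * (((Lc : ℝ) ^ 2)⁻¹) ^ j := by
  have hq' := abs_le_pi_of_mem_BZ hq
  have hLc1 : 1 ≤ Lc := by omega
  have hLc0 : (0 : ℝ) < Lc := by exact_mod_cast hLc1
  have hNM : Lc ^ (j + m) = Lc ^ j * Lc ^ m := pow_add _ _ _
  have hN'M' : Lc ^ (j + 1 + m) = Lc ^ (j + 1) * Lc ^ m := pow_add _ _ _
  have hNN' : Lc ^ (j + m) ≤ Lc ^ (j + 1 + m) := Nat.pow_le_pow_right hLc1 (by omega)
  have hT : ‖tSum (Lc ^ (j + 1 + m)) (Lc ^ (j + 1)) q κ l x' y' - tSum (Lc ^ (j + m)) (Lc ^ j) q κ l x' y'‖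
      ≤ tConst (Lc ^ m) (3 + 1) / (((Lc ^ (j + m) : ℕ) : ℝ)) ^ 2 := by
    have h := norm_tSum_jm_step_le hLc2 hm j hq' κ l x' y'
    push_cast
    exact h
  have h := ff_rate_of_data m j hq' hq0 κ l x' y' hT (rPhi_bound hNM hq' hq0 κ x') (rC_bound hNM hq' hq0 κ x')
    (rPhi_rate hNM hN'M' hNN' hq' hq0 κ x') (rC_rate hNM hN'M' hNN' hq' hq0 κ x') (srcPhi_bound hN'M' hq' hq0 l y')
    (srcC_bound hN'M' hq' hq0 l y') (srcPhi_rate' hNM hN'M' hNN' hq' hq0 l y') (srcC_rate' hNM hN'M' hNN' hq' hq0 l y')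
  refine h.trans (mul_le_mul_of_nonneg_right (div_le_div_of_nonneg_right ?_ (by positivity)) (by positivity))
  have hP := momSq_pos hq0
  set s := Real.sqrt (momSq q) with hs
  have hsP : momSq q = s ^ 2 := (Real.sq_sqrt hP.le).symm
  obtain ⟨hxφ, hxφ0⟩ := sq_mul_bPhi (Lc := Lc ^ m) hq' hq0
  obtain ⟨hxc, hxc0⟩ := cube_mul_bC (Lc := Lc ^ m) hq' hq0
  obtain ⟨hyc, hyc0⟩ := sqrt_mul_rC (Lc := Lc ^ m) hq' hq0
  have hs0 : 0 ≤ s := Real.sqrt_nonneg _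
  have h1 := (cPP_pos (3 + 1)).le; have h2 := (cPc_pos (3 + 1)).le; have h3 := crPP_nonneg (3 + 1); have h4 := crPc_nonneg (3 + 1)
  have h5 := rPhi_nonneg (Lc ^ m); have h6 := (ccc_pos (3 + 1)).le; have h7 := crcc_nonneg (3 + 1)
  have hU1 : 0 ≤ uPhi (Lc ^ m) := hxφ0.trans hxφ
  have hU2 : 0 ≤ uC (Lc ^ m) := hxc0.trans hxc
  have hU3 : 0 ≤ vC (Lc ^ m) := hyc0.trans hyc
  rw [hsP]
  calc tConst (Lc ^ m) (3 + 1)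
        + (((3 + 1 : ℕ) : ℝ) * (rPhi (Lc ^ m) * (((3 + 1 : ℕ) : ℝ) * (cPP (3 + 1) * s ^ 2 * bPhi (Lc ^ m) q) + cPc (3 + 1) * (s ^ 2 * s) * bC (Lc ^ m) q)
              + bPhi (Lc ^ m) q * (((3 + 1 : ℕ) : ℝ) * (crPP (3 + 1) * (s ^ 2) ^ 2 * bPhi (Lc ^ m) q + cPP (3 + 1) * s ^ 2 * rPhi (Lc ^ m))
                + crPc (3 + 1) * ((s ^ 2) ^ 2 * s) * bC (Lc ^ m) q + cPc (3 + 1) * (s ^ 2 * s) * rC (Lc ^ m) q))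
          + rC (Lc ^ m) q * (((3 + 1 : ℕ) : ℝ) * (cPc (3 + 1) * (s ^ 2 * s) * bPhi (Lc ^ m) q) + ccc (3 + 1) * (s ^ 2) ^ 2 * bC (Lc ^ m) q)
          + bC (Lc ^ m) q * (((3 + 1 : ℕ) : ℝ) * (crPc (3 + 1) * ((s ^ 2) ^ 2 * s) * bPhi (Lc ^ m) q + cPc (3 + 1) * (s ^ 2 * s) * rPhi (Lc ^ m))
                + crcc (3 + 1) * (s ^ 2) ^ 3 * bC (Lc ^ m) q + ccc (3 + 1) * (s ^ 2) ^ 2 * rC (Lc ^ m) q))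
      = tConst (Lc ^ m) (3 + 1)
        + (((3 + 1 : ℕ) : ℝ) * (rPhi (Lc ^ m) * (((3 + 1 : ℕ) : ℝ) * cPP (3 + 1) * (s ^ 2 * bPhi (Lc ^ m) q) + cPc (3 + 1) * (s ^ 3 * bC (Lc ^ m) q))
            + (((3 + 1 : ℕ) : ℝ) * crPP (3 + 1) * (s ^ 2 * bPhi (Lc ^ m) q) ^ 2 + ((3 + 1 : ℕ) : ℝ) * cPP (3 + 1) * (s ^ 2 * bPhi (Lc ^ m) q) * rPhi (Lc ^ m)
              + crPc (3 + 1) * (s ^ 2 * bPhi (Lc ^ m) q) * (s ^ 3 * bC (Lc ^ m) q) + cPc (3 + 1) * (s ^ 2 * bPhi (Lc ^ m) q) * (s * rC (Lc ^ m) q)))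
          + (((3 + 1 : ℕ) : ℝ) * cPc (3 + 1) * (s * rC (Lc ^ m) q) * (s ^ 2 * bPhi (Lc ^ m) q) + ccc (3 + 1) * (s * rC (Lc ^ m) q) * (s ^ 3 * bC (Lc ^ m) q))
          + (((3 + 1 : ℕ) : ℝ) * crPc (3 + 1) * (s ^ 3 * bC (Lc ^ m) q) * (s ^ 2 * bPhi (Lc ^ m) q) + ((3 + 1 : ℕ) : ℝ) * cPc (3 + 1) * (s ^ 3 * bC (Lc ^ m) q) * rPhi (Lc ^ m)
              + crcc (3 + 1) * (s ^ 3 * bC (Lc ^ m) q) ^ 2 + ccc (3 + 1) * (s ^ 3 * bC (Lc ^ m) q) * (s * rC (Lc ^ m) q))) := by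
          ring
    _ ≤ tConst (Lc ^ m) (3 + 1)
        + (((3 + 1 : ℕ) : ℝ) * (rPhi (Lc ^ m) * (((3 + 1 : ℕ) : ℝ) * cPP (3 + 1) * uPhi (Lc ^ m) + cPc (3 + 1) * uC (Lc ^ m))
            + (((3 + 1 : ℕ) : ℝ) * crPP (3 + 1) * uPhi (Lc ^ m) ^ 2 + ((3 + 1 : ℕ) : ℝ) * cPP (3 + 1) * uPhi (Lc ^ m) * rPhi (Lc ^ m)
              + crPc (3 + 1) * uPhi (Lc ^ m) * uC (Lc ^ m) + cPc (3 + 1) * uPhi (Lc ^ m) * vC (Lc ^ m)))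
          + (((3 + 1 : ℕ) : ℝ) * cPc (3 + 1) * vC (Lc ^ m) * uPhi (Lc ^ m) + ccc (3 + 1) * vC (Lc ^ m) * uC (Lc ^ m))
          + (((3 + 1 : ℕ) : ℝ) * crPc (3 + 1) * uC (Lc ^ m) * uPhi (Lc ^ m) + ((3 + 1 : ℕ) : ℝ) * cPc (3 + 1) * uC (Lc ^ m) * rPhi (Lc ^ m)
              + crcc (3 + 1) * uC (Lc ^ m) ^ 2 + ccc (3 + 1) * uC (Lc ^ m) * vC (Lc ^ m))) := by gcongr

/-- **mm LEG at (j, m), `q`-UNIFORM** [folklore]: `≤ cmm (Lc^m)·(Lc⁻²)^j` on `BZ ∖ {0}` (`|q|² ≤ 4π²`). -/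
theorem mm_leg (m j : ℕ) (hq : q ∈ BZ (3 + 1)) (hq0 : q ≠ 0) (κ l : Fin (3 + 1)) :
    ‖((smStep 3 Lc (j + 1) * smStep 3 Lc (j + 1) : ℝ) : ℂ) * phiSol (Lc ^ (j + 1 + m)) (ofRealVec q) 0 (eVec l) κ
        - ((smStep 3 Lc j * smStep 3 Lc j : ℝ) : ℂ) * phiSol (Lc ^ (j + m)) (ofRealVec q) 0 (eVec l) κ‖
      ≤ cmm (Lc ^ m) * (((Lc : ℝ) ^ 2)⁻¹) ^ j := by
  have hq' := abs_le_pi_of_mem_BZ hq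
  refine (mm_rate m j hq' hq0 κ l).trans ?_
  unfold FibreRateOfLegs.cmm
  have hP : momSq q ≤ 4 * π ^ 2 := (sqrt_momSq_le hq').2
  have hP0 : 0 ≤ momSq q := momSq_nonneg q
  have hc := crPP_nonneg (3 + 1)
  have h2 : momSq q ^ 2 ≤ (4 * π ^ 2) ^ 2 := pow_le_pow_left₀ hP0 hP 2
  have hθ : 0 ≤ (((Lc : ℝ) ^ 2)⁻¹) ^ j := by positivity
  exact mul_le_mul_of_nonneg_right (div_le_div_of_nonneg_right (mul_le_mul_of_nonneg_left h2 hc) (by positivity)) hθ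

end Legs

end Summit.QuantumFields.BalabanUV.Beta.GAN24.FibreRateJM

end
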